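import Summits.FinalStateConjecture.FinalStateConjecture.Theorems.ChannelsResolveTameDevelopmentsR.Negative.SlabMinkowski
import Mathlib.Analysis.Calculus.Darboux
import HarnessLib

/-!
# The time slab of Minkowski space admits no final-state decomposition: no late Kerr chart and no late
# flat chart maps into `{-1 < x⁰ < 1}` — negative-side support for the crux `ChannelsResolveTameDevelopmentsR`
# (K2R, item `stmt-FinalStateConjecture-14075`)

Sequel of `SlabMinkowski`. The one analytic lemma (`slab_chart_false`): a smooth chart `Ψ` from an open
subset `O ⊆ E4` into the slab development, and an affine coordinate line `s ↦ p₀ + s u` of `O` whose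
image direction `dΨ(u)` is eventually uniformly timelike, `η(dΨ u, dΨ u) ≤ -1/2`, are contradictory —
along the image curve the time coordinate `x⁰` has derivative of absolute value `≥ 1/√2` and constant sign
(Darboux), so it cannot stay in `(-1, 1)` (`not_trapped_of_half_le_sq_deriv`). Consequences:

* `slab_no_holeChart` — for EVERY `(Λ, c, M, a)` there is no late-time chart from the boosted Kerr exterior
  `boostedKerrBackground Λ c M a` into the slab whose truncated `Cᵏ` deviation tends to `0` on all near-zone
  slabs: the rest-frame `t*`-line through the axis point `(0, 0, 5|M| + 1)` has `g_{M,a}(∂_{t*}, ∂_{t*}) =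
  -1 + 2H ≤ -3/5` (`kerr_bilin_axisPoint_le`), and `C⁰`-closeness on the truncated slabs makes its image
  uniformly timelike. In particular hypothesis (i) of K2R/Φ (no EXTREMAL late chart) holds for the slab
  (`slab_noExtremalChart`, exact form of the route decl);
* `slab_no_flatChart` — with `N = 0` a final-state decomposition's flat chart is defined on the whole late
  half-space, and the `x⁰`-axis is uniformly timelike for `η`;
* `isEmpty_finalStateDecomposition_slab` — hence NO region of the slab development carries a final-state
  decomposition in any `Cᵏ`, and the conclusion of K2R/Φ fails for it (`slab_not_settles`).

All results proved; no named facts.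

## References

* M. Dafermos, G. Holzegel, I. Rodnianski, M. Taylor, arXiv:2104.08222, §1 (late charts, deviation).
* B. O'Neill, *Semi-Riemannian geometry*, 1983, Ch. 5, p. 145 (timecones of `ℝ⁴₁`).
-/

noncomputable section

open Bundle Set Function Filter TopologicalSpace Topology
open scoped Manifold ContDiff Topology ENNReal

set_option linter.dupNamespace false
-- the operator-norm instance on `E4 →L[ℝ] E4 →L[ℝ] ℝ` (values of the deviation) needs one more level of
-- pending instance problems than the default (as in `Literature/Geometry/Lorentzian/BoundedGeometry.lean`)
set_option maxSynthPendingDepth 3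

namespace Summit.FinalStateConjecture.FinalStateConjecture.Theorems.ChannelsResolveTameDevelopmentsR.Negative

open Literature.Geometry.Lorentzian Literature.Geometry.Lorentzian.Minkowski

/-! ### The real-variable core: a trapped function cannot have a large derivative forever -/

/-- **Core (real analysis).** A real function on `[s₁, ∞)` whose derivative has square `≥ 1/2`
everywhere cannot stay in `(-1, 1)`: the derivative never vanishes, so (Darboux) it has constant sign,
and then the function moves by at least `2` over a parameter interval of length `4`. -/
theorem not_trapped_of_half_le_sq_deriv {T T' : ℝ → ℝ} {s₁ : ℝ}
    (hT : ∀ s, s₁ ≤ s → HasDerivAt T (T' s) s) (hT' : ∀ s, s₁ ≤ s → 1 / 2 ≤ T' s ^ 2)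
    (hmem : ∀ s, s₁ ≤ s → |T s| < 1) : False := by
  have hne : ∀ s ∈ Ici s₁, T' s ≠ 0 := fun s hs h0 ↦ by
    have := hT' s hs; rw [h0] at this; norm_num at this
  have hcont : ContinuousOn T (Icc s₁ (s₁ + 4)) := fun s hs ↦
    (hT s hs.1).continuousAt.continuousWithinAt
  have hdiff : DifferentiableOn ℝ T (interior (Icc s₁ (s₁ + 4))) := fun s hs ↦
    (hT s (interior_subset hs).1).differentiableAt.differentiableWithinAt
  have h4 : s₁ + 4 ∈ Icc s₁ (s₁ + 4) := ⟨by linarith, le_rfl⟩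
  have h0 : s₁ ∈ Icc s₁ (s₁ + 4) := ⟨le_rfl, by linarith⟩
  have hlt1 := hmem s₁ le_rfl
  have hlt2 := hmem (s₁ + 4) (by linarith)
  rw [abs_lt] at hlt1 hlt2
  rcases hasDerivWithinAt_forall_lt_or_forall_gt_of_forall_ne (convex_Ici s₁)
    (fun s hs ↦ (hT s hs).hasDerivWithinAt) hne with hneg | hpos
  · -- derivative `≤ -1/2` everywhere: `T` drops by `2` on `[s₁, s₁ + 4]`
    have hle : ∀ s ∈ interior (Icc s₁ (s₁ + 4)), deriv T s ≤ -(1 / 2) := by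
      intro s hs
      have hs₁ : s₁ ≤ s := (interior_subset hs).1
      rw [(hT s hs₁).deriv]
      have h1 := hneg s hs₁
      have h2 := hT' s hs₁
      nlinarith
    have := (convex_Icc s₁ (s₁ + 4)).image_sub_le_mul_sub_of_deriv_le hcont hdiff hle s₁ h0
      (s₁ + 4) h4 (by linarith)
    linarith
  · -- derivative `≥ 1/2` everywhere: `T` grows by `2` on `[s₁, s₁ + 4]`
    have hge : ∀ s ∈ interior (Icc s₁ (s₁ + 4)), 1 / 2 ≤ deriv T s := by
      intro s hs
      have hs₁ : s₁ ≤ s := (interior_subset hs).1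
      rw [(hT s hs₁).deriv]
      have h1 := hpos s hs₁
      have h2 := hT' s hs₁
      nlinarith
    have := (convex_Icc s₁ (s₁ + 4)).mul_sub_le_image_sub_of_le_deriv hcont hdiff hge s₁ h0
      (s₁ + 4) h4 (by linarith)
    linarith

/-- A timelike vector `η(W, W) ≤ -1/2` has time component of square `≥ 1/2`. -/
theorem half_le_sq_apply_zero_of_bilin_le {W : E4} (h : bilin W W ≤ -(1 / 2)) :
    1 / 2 ≤ W 0 ^ 2 := by
  rw [bilin_apply] at h
  have hs : 0 ≤ ∑ i : Fin 3, W i.succ * W i.succ :=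
    Finset.sum_nonneg fun i _ ↦ mul_self_nonneg _
  nlinarith

/-! ### Curves in the model space `E4`: velocity versus derivative -/

/-- For a curve in the model vector space `E4`, the manifold velocity is the ordinary derivative. -/
theorem velocity_eq_deriv (c : ℝ → E4) (s : ℝ) : (velocity 𝓘(ℝ, E4) c s : E4) = deriv c s := by
  change mfderiv 𝓘(ℝ, ℝ) 𝓘(ℝ, E4) c s (1 : ℝ) = deriv c s
  rw [mfderiv_eq_fderiv]
  rfl

/-! ### The chart lemma -/

/-- The deviation of a chart into the slab development, unfolded: `(Ψ^* g − g₀)(x)(v, w) =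
η(dΨ v, dΨ w) − g₀(x)(v, w)` (the slab metric is `η` at every point). -/
theorem slab_deviation_apply {B : ModelBackground} (Ψ : B.domain → slab.carrier) (x : B.domain)
    (v w : E4) :
    slab.toSpacetime.deviation B Ψ x v w =
      bilin (mfderiv 𝓘(ℝ, E4) (𝓡 4) Ψ x v) (mfderiv 𝓘(ℝ, E4) (𝓡 4) Ψ x w) - B.bilin x.1 v w :=
  rfl

/-- **The chart lemma.** Let `Ψ : O → slab` be a `C^∞` map from an open subset `O ⊆ E4` into the slab
development and `σ : ℝ → O` a curve which is eventually the affine line `s ↦ p₀ + s • u`. If the image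
direction `dΨ_{σ(s)}(u)` is eventually uniformly timelike, `η(dΨ u, dΨ u) ≤ -1/2`, we reach a
contradiction: the time coordinate of `Ψ(σ(s))` is trapped in `(-1, 1)` but has derivative
`(dΨ u)⁰` of square `≥ 1/2` (`not_trapped_of_half_le_sq_deriv`). -/
theorem slab_chart_false {O : Opens E4} (Ψ : O → slab.carrier)
    (hΨ : ContMDiff 𝓘(ℝ, E4) (𝓡 4) ∞ Ψ) (σ : ℝ → O) (p₀ u : E4) (s₀ : ℝ)
    (hσ : ∀ s, s₀ < s → (σ s : E4) = p₀ + s • u)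
    (hdev : ∀ᶠ s in atTop,
      bilin (mfderiv 𝓘(ℝ, E4) (𝓡 4) Ψ (σ s) u) (mfderiv 𝓘(ℝ, E4) (𝓡 4) Ψ (σ s) u) ≤ -(1 / 2)) :
    False := by
  obtain ⟨S, hS⟩ := eventually_atTop.1 hdev
  set s₁ : ℝ := max (s₀ + 1) S with hs₁
  -- the image curve in coordinates and its time coordinate
  set C : ℝ → E4 := fun s ↦ Subtype.val (Ψ (σ s)) with hC
  set W : ℝ → E4 := fun s ↦ mfderiv 𝓘(ℝ, E4) (𝓡 4) Ψ (σ s) u with hW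
  -- derivative of the coordinate curve along the line
  have hderiv : ∀ s, s₁ ≤ s → HasDerivAt C (W s) s := by
    intro s hs
    have hs₀ : s₀ < s := by
      have : s₀ + 1 ≤ s := le_trans (le_max_left _ _) hs
      linarith
    -- the line in `O`
    have hline : HasDerivAt (fun s' ↦ p₀ + s' • u) u s := by
      simpa using ((hasDerivAt_id s).smul_const u).const_add p₀
    have hσev : (Subtype.val ∘ σ) =ᶠ[𝓝 s] fun s' ↦ p₀ + s' • u := by
      filter_upwards [Ioi_mem_nhds hs₀] with s' hs'
      exact hσ s' hs'
    have hσval : HasDerivAt (Subtype.val ∘ σ) u s := hline.congr_of_eventuallyEq hσev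
    have hσd : MDifferentiableAt 𝓘(ℝ, ℝ) 𝓘(ℝ, E4) σ s :=
      (mdifferentiableAt_subtypeVal_comp_curve_iff O).1
        (mdifferentiableAt_iff_differentiableAt.2 hσval.differentiableAt)
    have hσvel : (velocity 𝓘(ℝ, E4) σ s : E4) = u := by
      rw [← velocity_subtypeVal_comp O σ s, velocity_eq_deriv, hσval.deriv]
    -- the chart
    have hΨd : MDifferentiableAt 𝓘(ℝ, E4) (𝓡 4) Ψ (σ s) := (hΨ (σ s)).mdifferentiableAt (by simp)
    have hcomp : MDifferentiableAt 𝓘(ℝ, ℝ) (𝓡 4) (Ψ ∘ σ) s := hΨd.comp s hσd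
    have hvelcomp : (velocity (𝓡 4) (Ψ ∘ σ) s : E4) = W s := by
      change mfderiv 𝓘(ℝ, ℝ) (𝓡 4) (Ψ ∘ σ) s (1 : ℝ) = _
      rw [mfderiv_comp s hΨd hσd]
      change mfderiv 𝓘(ℝ, E4) (𝓡 4) Ψ (σ s) (velocity 𝓘(ℝ, E4) σ s) = _
      rw [hσvel]
    -- the inclusion into `E4`
    have hCd : MDifferentiableAt 𝓘(ℝ, ℝ) (𝓡 4) C s :=
      (mdifferentiableAt_subtypeVal_comp_curve_iff slabCut).2 hcomp
    have hCd' : DifferentiableAt ℝ C s := mdifferentiableAt_iff_differentiableAt.1 hCd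
    have hCvel : (velocity (𝓡 4) C s : E4) = W s := by
      rw [← hvelcomp]
      exact velocity_subtypeVal_comp slabCut (Ψ ∘ σ) s
    have hCderiv : deriv C s = W s := by rw [← hCvel]; exact (velocity_eq_deriv C s).symm
    rw [← hCderiv]
    exact hCd'.hasDerivAt
  -- the time coordinate and its derivative
  refine not_trapped_of_half_le_sq_deriv (T := fun s ↦ C s 0) (T' := fun s ↦ W s 0) (s₁ := s₁)
    (fun s hs ↦ ?_) (fun s hs ↦ ?_) (fun s hs ↦ ?_)
  · have h1 := ((EuclideanSpace.proj (0 : Fin 4) : E4 →L[ℝ] ℝ).hasFDerivAt.comp_hasDerivAt s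
      (hderiv s hs))
    simpa [Function.comp_def] using h1
  · exact half_le_sq_apply_zero_of_bilin_le (hS s (le_trans (le_max_right _ _) hs))
  · exact abs_lt.2 (by simpa [neg_lt] using slab_apply_zero_mem (Ψ (σ s)))


/-- **The chart lemma for a model background.** Let `Ψ : B.domain → slab` be a `C^∞` chart map of the
slab development on the background `B`, and `σ` an eventually affine line `s ↦ p₀ + s • u` of `B.domain`
along which (a) the background direction `u` is uniformly timelike, `g₀(σ s)(u, u) ≤ -3/5`, and (b) the
operator norm of the deviation `(Ψ^* g − g₀)(σ s)` is eventually below any `ε > 0`. Then `False`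
(`slab_chart_false` with the margin `1/10`). -/
theorem slab_background_chart_false {B : ModelBackground} (Ψ : B.domain → slab.carrier)
    (hΨ : ContMDiff 𝓘(ℝ, E4) (𝓡 4) ∞ Ψ) (σ : ℝ → B.domain) (p₀ u : E4) (s₀ : ℝ)
    (hσ : ∀ s, s₀ < s → (σ s : E4) = p₀ + s • u)
    (hbg : ∀ᶠ s in atTop, B.bilin (σ s).1 u u ≤ -(3 / 5))
    (hdev : ∀ ε : ℝ, 0 < ε → ∀ᶠ s in atTop, ‖slab.toSpacetime.deviation B Ψ (σ s)‖ < ε) : False := by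
  set ε : ℝ := 1 / (10 * (‖u‖ ^ 2 + 1)) with hε
  have hεpos : 0 < ε := by positivity
  refine slab_chart_false Ψ hΨ σ p₀ u s₀ hσ ?_
  filter_upwards [hbg, hdev ε hεpos] with s hb hd
  have happ := slab_deviation_apply Ψ (σ s) u u
  have hle : |slab.toSpacetime.deviation B Ψ (σ s) u u| ≤ ε * ‖u‖ ^ 2 := by
    have h1 := (slab.toSpacetime.deviation B Ψ (σ s)).le_opNorm₂ u u
    rw [Real.norm_eq_abs] at h1
    refine h1.trans ?_
    rw [pow_two, ← mul_assoc]
    gcongr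
  have hεu : ε * ‖u‖ ^ 2 ≤ 1 / 10 := by
    rw [hε, div_mul_eq_mul_div, one_mul, div_le_div_iff₀ (by positivity) (by norm_num)]
    nlinarith [sq_nonneg ‖u‖]
  have habs := (abs_le.1 (hle.trans hεu)).2
  linarith

/-- The smallness hypothesis (b) of `slab_background_chart_false` from a vanishing `Cᵏ` sup norm of the
deviation on sets containing the points `σ s` (the `m = 0` term of `supCkENorm` controls the value). -/
theorem eventually_norm_deviation_lt {B : ModelBackground} (Ψ : B.domain → slab.carrier) {k : ℕ}
    (σ : ℝ → B.domain) (S : ℝ → Set B.domain) (hS : ∀ᶠ s in atTop, σ s ∈ S s)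
    (hT : Tendsto (fun s ↦ supCkENorm (Subtype.val '' S s) k (slab.toSpacetime.deviationExtend B Ψ))
      atTop (𝓝 0)) {ε : ℝ} (hε : 0 < ε) :
    ∀ᶠ s in atTop, ‖slab.toSpacetime.deviation B Ψ (σ s)‖ < ε := by
  have hε' : (0 : ℝ≥0∞) < ENNReal.ofReal ε := ENNReal.ofReal_pos.2 hε
  filter_upwards [hS, hT.eventually (gt_mem_nhds hε')] with s hs hlt
  have h1 := enorm_iteratedFDeriv_le_supCkENorm (S := Subtype.val '' S s) (k := k) (m := 0)
    (Nat.zero_le k) (x := ((σ s : B.domain) : E4)) (mem_image_of_mem _ hs)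
    (slab.toSpacetime.deviationExtend B Ψ)
  rw [← ofReal_norm, norm_iteratedFDeriv_zero, Spacetime.deviationExtend_coe] at h1
  exact (ENNReal.ofReal_lt_ofReal_iff hε).1 (h1.trans_lt hlt)

/-- Smallness of the deviation along a line of points `σ s` on the truncated slabs `{t = s, r ≤ R}`, from
vanishing truncated `Cᵏ` deviation (the hypothesis of a hole chart of a final-state decomposition). -/
theorem eventually_norm_deviation_lt_of_trunc {B : ModelBackground} (Ψ : B.domain → slab.carrier)
    {k : ℕ} {R : ℝ} (σ : ℝ → B.domain) (hσ : ∀ s, B.time (σ s).1 = s ∧ B.radius (σ s).1 ≤ R)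
    (hT : Tendsto (fun τ ↦ slab.toSpacetime.truncDeviationCk B Ψ k R τ) atTop (𝓝 0)) {ε : ℝ}
    (hε : 0 < ε) : ∀ᶠ s in atTop, ‖slab.toSpacetime.deviation B Ψ (σ s)‖ < ε :=
  eventually_norm_deviation_lt Ψ σ (fun s ↦ B.truncTimeSlab R s) (Eventually.of_forall hσ) hT hε

/-- Smallness of the deviation along a line of points `σ s` eventually on the slabs `{t = s}`, from
vanishing full `Cᵏ` slab deviation (the hypothesis of the flat chart of a final-state decomposition). -/
theorem eventually_norm_deviation_lt_of_slab {B : ModelBackground} (Ψ : B.domain → slab.carrier)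
    {k : ℕ} (σ : ℝ → B.domain) (hσ : ∀ᶠ s in atTop, B.time (σ s).1 = s)
    (hT : Tendsto (fun τ ↦ slab.toSpacetime.deviationCk B Ψ k τ) atTop (𝓝 0)) {ε : ℝ}
    (hε : 0 < ε) : ∀ᶠ s in atTop, ‖slab.toSpacetime.deviation B Ψ (σ s)‖ < ε :=
  eventually_norm_deviation_lt Ψ σ (fun s ↦ B.timeSlab s) hσ hT hε

/-! ### A uniformly timelike coordinate line of every boosted Kerr background -/

/-- The Kerr–Schild radius of the axis point `(s, 0, 0, z₀)`, `z₀ > 0`, is `z₀`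
(`r⁴ − (z₀² − a²) r² − a² z₀² = (r² − z₀²)(r² + a²)`). -/
theorem kerr_radius_axisPoint (a : ℝ) {z₀ : ℝ} (hz : 0 < z₀) (s : ℝ) :
    Kerr.radius a (E4.ofTimeSpace s (z₀ • EuclideanSpace.single 2 1)) = z₀ := by
  set P : E4 := E4.ofTimeSpace s (z₀ • EuclideanSpace.single 2 1) with hP
  have hn : E4.spatialNorm P = z₀ := by
    rw [hP, E4.spatialNorm_ofTimeSpace, norm_smul, PiLp.norm_single, norm_one, mul_one,
      Real.norm_eq_abs, abs_of_pos hz]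
  have h3 : P 3 = z₀ := by
    rw [hP, show (3 : Fin 4) = (2 : Fin 3).succ from rfl, E4.ofTimeSpace_apply_succ]
    simp
  rw [Kerr.radius, hn, h3, show (z₀ ^ 2 - a ^ 2) ^ 2 + 4 * a ^ 2 * z₀ ^ 2 = (z₀ ^ 2 + a ^ 2) ^ 2 by ring,
    Real.sqrt_sq (by positivity), show (z₀ ^ 2 - a ^ 2 + (z₀ ^ 2 + a ^ 2)) / 2 = z₀ ^ 2 by ring,
    Real.sqrt_sq hz.le]

/-- **On the axis point `(s, 0, 0, 5|M| + 1)` the Kerr–Schild time direction is uniformly timelike**: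
`g_{M,a}(∂₀, ∂₀) = -1 + 2H ≤ -3/5`, because there `H = M z₀³/(z₀⁴ + a² z₀²) ≤ |M|/z₀ < 1/5`; for EVERY
real `M`, `a` (no sign or extremality condition). -/
theorem kerr_bilin_axisPoint_le (M a s : ℝ) :
    Kerr.bilin M a (E4.ofTimeSpace s ((5 * |M| + 1) • EuclideanSpace.single 2 1))
      (E4.basisVector 0) (E4.basisVector 0) ≤ -(3 / 5) := by
  set z₀ : ℝ := 5 * |M| + 1 with hz₀
  have hz : 0 < z₀ := by positivity
  set P : E4 := E4.ofTimeSpace s (z₀ • EuclideanSpace.single 2 1) with hP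
  have hr : Kerr.radius a P = z₀ := kerr_radius_axisPoint a hz s
  have h3 : P 3 = z₀ := by
    rw [hP, show (3 : Fin 4) = (2 : Fin 3).succ from rfl, E4.ofTimeSpace_apply_succ]
    simp
  have hH : Kerr.scalarH M a P ≤ 1 / 5 := by
    rw [Kerr.scalarH, hr, h3, div_le_iff₀ (by positivity)]
    have hM : M * z₀ ^ 3 ≤ |M| * z₀ ^ 3 := by gcongr; exact le_abs_self M
    have h5 : |M| ≤ z₀ / 5 := by rw [hz₀]; linarith [abs_nonneg M]
    nlinarith [sq_nonneg a, pow_pos hz 2, pow_pos hz 3]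
  rw [Kerr.bilin_apply, Kerr.nullCovector_basisVector_zero, bilin_basisVector_zero]
  linarith

/-! ### No late Kerr chart maps into the slab -/

/-- **No late-time chart of ANY boosted Kerr exterior into the slab development has truncated `Cᵏ`
deviation tending to zero on all near-zone slabs.** Along the rest-frame `t*`-line through the axis point
`(0, 0, 5|M| + 1)` (radius `5|M| + 1 > r₊`) the background direction `Λ ∂₀` is uniformly timelike
(`kerr_bilin_axisPoint_le`) and the truncated deviation with `R = 5|M| + 1` controls the deviation there;
`slab_background_chart_false` concludes. Only smoothness of the chart is used. -/
theorem slab_no_holeChart (Λ : lorentzGroup) (c : E4) (M a : ℝ) {k : ℕ}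
    (Ψ : (boostedKerrBackground Λ c M a).domain → slab.carrier) (hΨ : ContMDiff 𝓘(ℝ, E4) (𝓡 4) ∞ Ψ)
    (hdev : ∀ R : ℝ, Tendsto
      (fun τ ↦ slab.toSpacetime.truncDeviationCk (boostedKerrBackground Λ c M a) Ψ k R τ) atTop (𝓝 0)) :
    False := by
  have hz : 0 < 5 * |M| + 1 := by positivity
  -- the rest-frame axis points `P s = (s, 0, 0, z₀)` and their boosted images `c + Λ (P s)`
  have hinv : ∀ s, poincareInv Λ c (c + (Λ : E4 ≃L[ℝ] E4)
      (E4.ofTimeSpace s ((5 * |M| + 1) • EuclideanSpace.single 2 1))) =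
        E4.ofTimeSpace s ((5 * |M| + 1) • EuclideanSpace.single 2 1) := fun s ↦ by
    simp [poincareInv]
  have hrad : ∀ s, Kerr.radius a (E4.ofTimeSpace s ((5 * |M| + 1) • EuclideanSpace.single 2 1)) =
      5 * |M| + 1 := fun s ↦ kerr_radius_axisPoint a hz s
  have hrPlus : Kerr.rPlus M a < 5 * |M| + 1 := by
    have h1 : √(M ^ 2 - a ^ 2) ≤ |M| := by
      rw [← Real.sqrt_sq_eq_abs]
      exact Real.sqrt_le_sqrt (by nlinarith [sq_nonneg a])
    have h2 : M ≤ |M| := le_abs_self M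
    rw [Kerr.rPlus]
    linarith [abs_nonneg M]
  have hmem : ∀ s, c + (Λ : E4 ≃L[ℝ] E4) (E4.ofTimeSpace s ((5 * |M| + 1) • EuclideanSpace.single 2 1)) ∈
      (boostedKerrBackground Λ c M a).domain := fun s ↦ by
    change _ ∈ boostedKerrExterior Λ c M a
    rw [mem_boostedKerrExterior, hinv, Kerr.mem_exterior, hrad]
    exact max_lt hrPlus hz
  set σ : ℝ → (boostedKerrBackground Λ c M a).domain := fun s ↦ ⟨_, hmem s⟩ with hσ
  refine slab_background_chart_false Ψ hΨ σ
    (c + (Λ : E4 ≃L[ℝ] E4) (E4.ofTimeSpace 0 ((5 * |M| + 1) • EuclideanSpace.single 2 1)))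
    ((Λ : E4 ≃L[ℝ] E4) (E4.basisVector 0)) 0 (fun s _ ↦ ?_) (Eventually.of_forall fun s ↦ ?_)
    (fun ε hε ↦ ?_)
  · -- the line is affine with direction `Λ ∂₀`
    change c + (Λ : E4 ≃L[ℝ] E4) (E4.ofTimeSpace s ((5 * |M| + 1) • EuclideanSpace.single 2 1)) = _
    rw [E4.ofTimeSpace_eq_smul_add s, map_add, map_smul]
    abel
  · -- the background direction is uniformly timelike
    change boostedKerrBilin Λ c M a
      (c + (Λ : E4 ≃L[ℝ] E4) (E4.ofTimeSpace s ((5 * |M| + 1) • EuclideanSpace.single 2 1)))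
      ((Λ : E4 ≃L[ℝ] E4) (E4.basisVector 0)) ((Λ : E4 ≃L[ℝ] E4) (E4.basisVector 0)) ≤ _
    rw [boostedKerrBilin_apply, hinv, ContinuousLinearEquiv.symm_apply_apply]
    exact kerr_bilin_axisPoint_le M a s
  · -- the deviation is eventually small at the points of the line (truncated slabs, `R = z₀`)
    refine eventually_norm_deviation_lt_of_trunc Ψ σ (R := 5 * |M| + 1) (fun s ↦ ?_) (hdev _) hε
    change (poincareInv Λ c (c + (Λ : E4 ≃L[ℝ] E4)
        (E4.ofTimeSpace s ((5 * |M| + 1) • EuclideanSpace.single 2 1)))) 0 = s ∧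
      Kerr.radius a (poincareInv Λ c (c + (Λ : E4 ≃L[ℝ] E4)
        (E4.ofTimeSpace s ((5 * |M| + 1) • EuclideanSpace.single 2 1)))) ≤ 5 * |M| + 1
    rw [hinv, hrad]
    exact ⟨rfl, le_rfl⟩

/-- **Hypothesis (i) of K2R / Φ holds for the slab development** (no extremal boosted-Kerr late chart
with vanishing truncated `C²` deviation), in the exact form of the route decl instantiated at `𝒟 := slab`:
a special case of `slab_no_holeChart` (which needs neither extremality nor the embedding property). -/
theorem slab_noExtremalChart :
    ∀ (Λ : lorentzGroup) (c : E4) (M a : ℝ), Kerr.IsExtremal M a →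
      ¬ ∃ (τ₀ : ℝ) (Ψ : (boostedKerrBackground Λ c M a).domain → slab.carrier),
        slab.toSpacetime.IsLateChart (boostedKerrBackground Λ c M a) Set.univ τ₀ Ψ ∧
          ∀ R : ℝ, Tendsto
            (fun τ ↦ slab.toSpacetime.truncDeviationCk (boostedKerrBackground Λ c M a) Ψ 2 R τ)
            atTop (𝓝 0) := by
  rintro Λ c M a - ⟨τ₀, Ψ, hΨ, hdev⟩
  exact slab_no_holeChart Λ c M a Ψ hΨ.contMDiff hdev

/-! ### No final-state decomposition of any region of the slab -/

/-- **A final-state decomposition of a region of the slab development has no flat chart either**: with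
`N = 0` the flat domain contains the whole late half-space `{x⁰ > τ₀}` (anti-vacuity clause
`setOf_lt_excision_subset_flatDomain`), the `x⁰`-axis `s ↦ (s, 0)` is an `η`-timelike line of it, and the
full `Cᵏ` slab deviation controls the deviation there; `slab_background_chart_false` concludes. -/
theorem slab_no_flatChart {O : Set slab.carrier} {k : ℕ} (d : FinalStateDecomposition slab.toSpacetime O k)
    (hN : d.N = 0) : False := by
  have hmem : ∀ s, E4.ofTimeSpace (max s (d.τ₀ + 1)) 0 ∈ (Minkowski.backgroundOn d.flatDomain).domain :=
    fun s ↦ d.lateRegion_subset_flatDomain_of_N_eq_zero hN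
      (show d.τ₀ < (E4.ofTimeSpace (max s (d.τ₀ + 1)) 0) 0 by
        rw [E4.ofTimeSpace_apply_zero]; exact lt_of_lt_of_le (lt_add_one _) (le_max_right _ _))
  set σ : ℝ → (Minkowski.backgroundOn d.flatDomain).domain :=
    fun s ↦ ⟨E4.ofTimeSpace (max s (d.τ₀ + 1)) 0, hmem s⟩ with hσ
  refine slab_background_chart_false (B := Minkowski.backgroundOn d.flatDomain) d.flatChart
    d.isLateChart_flat.contMDiff σ (E4.ofTimeSpace 0 0) (E4.basisVector 0) (d.τ₀ + 1) (fun s hs ↦ ?_)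
    (Eventually.of_forall fun s ↦ ?_) (fun ε hε ↦ ?_)
  · change E4.ofTimeSpace (max s (d.τ₀ + 1)) 0 = _
    rw [max_eq_left hs.le, E4.ofTimeSpace_eq_smul_add s, add_comm]
  · change bilin (E4.basisVector 0) (E4.basisVector 0) ≤ _
    rw [bilin_basisVector_zero]
    norm_num
  · refine eventually_norm_deviation_lt_of_slab (B := Minkowski.backgroundOn d.flatDomain) d.flatChart σ ?_
      d.tendsto_deviationCk_flat hε
    filter_upwards [eventually_gt_atTop (d.τ₀ + 1)] with s hs
    change (E4.ofTimeSpace (max s (d.τ₀ + 1)) 0) 0 = s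
    rw [E4.ofTimeSpace_apply_zero, max_eq_left hs.le]

/-- **No region of the slab development admits a final-state decomposition, in any `Cᵏ`.** With at least
one hole, the first hole chart contradicts `slab_no_holeChart`; with none, the flat chart contradicts
`slab_no_flatChart`. -/
theorem isEmpty_finalStateDecomposition_slab (O : Set slab.carrier) (k : ℕ) :
    IsEmpty (FinalStateDecomposition slab.toSpacetime O k) := by
  refine ⟨fun d ↦ ?_⟩
  rcases Nat.eq_zero_or_pos d.N with hN | hN
  · exact slab_no_flatChart d hN
  · set i : Fin d.N := ⟨0, hN⟩
    exact slab_no_holeChart (d.motion i).1 (d.motion i).2 (d.mass i) (d.spin i) (d.chart i)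
      (d.isLateChart i).contMDiff (d.tendsto_truncDeviationCk i)

/-- **The conclusion of K2R / Φ fails for the slab development**: there is no region `O` with an honest
exhaustive `2`-decomposition — indeed no `FinalStateDecomposition` of any region at all
(`isEmpty_finalStateDecomposition_slab`). Exact form of the route decl instantiated at `𝒟 := slab`. -/
theorem slab_not_settles :
    ¬ ∃ (O : Set slab.carrier) (d : FinalStateDecomposition slab.toSpacetime O 2),
      O = _root_.Summit.FinalStateConjecture.exteriorOf slab.toCauchyDevelopment d.charted ∧
        _root_.Summit.FinalStateConjecture.HasExhaustiveCharts d := by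
  rintro ⟨O, d, -⟩
  exact (isEmpty_finalStateDecomposition_slab O 2).false d

end Summit.FinalStateConjecture.FinalStateConjecture.Theorems.ChannelsResolveTameDevelopmentsR.Negative

end
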